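import Summits.QuantumFields.BalabanUV.T4Continuum.Support.AveragingDeficitDualResidual

/-!
# T⁴ programme, node NE3, route P2 «ENERGY CONVEXITY» — leaf L7 (SRC), background point: the FIRST VARIATION of the
# Wilson action of a small-field `U(N)` configuration along a `𝔲(N)` direction is bounded by (plaquette radius) ×
# (`ℓ¹` norm of the dressed curl of the direction), hence by `2·#planes·a·‖ψ‖_{ℓ¹}` over one period

Eleventh generation of the NE3 prover lineage P2 (unit `b2b-balaban-t4-ne3-p2`, co-owner #2 of `BINDER-OWNERS.md` row
NE3; ROUND-2 SKELETON-FIRST mandate), leaf L7 of the skeleton `HOME/t4/skeletons/NE3-t4-ne3-p2.md` at the background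
point of the path (chart coordinate `A = 0`).  WHY IT MATTERS.  In the one-path form of the energy response
(`Support/NE3EnergyPath.energyResponse_of_pathData`, p206756) the second derivative of the action along an admissible
path splits as `Hess[γ′, γ′] + d𝒜(γ_t)[γ″_t]`; the CURVATURE TERM `d𝒜(γ_t)[γ″_t]` is small because the first variation
of the Wilson action at a SMALL-FIELD configuration is itself small in the dual-`ℓ¹` norm — B11's «|J| < C₁B₃ε₁(L^jη)⁻³»
((28) p. 282) is the printed sup form of this at the background; here the kernel form: for `V` unitary with
`‖V(∂p) − 1‖ ≤ a` on the window and `ψ` skew,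
  `|d/ds|₀ Σ_{p ∈ W}(1 − Re tr V_s(∂p))| = |Σ_p Re tr((d_Vψ)(p)·V(∂p))| ≤ a · Σ_p ‖(d_Vψ)(p)‖`
(§2 `abs_sum_nReTr_curl_fhol_le`, §3 `abs_firstVariation_le`), because `Re tr((d_Vψ)(p)) = 0` (the dressed curl is skew,
tree `curl_mem_skewAdjoint` + `nReTr_eq_zero_of_mem_skewAdjoint`) so only `V(∂p) − 1` is seen; and over one period of a
periodic direction `≤ 2·#planes·a·‖ψ‖_{ℓ¹(period)}` (§4 `abs_firstVariation_periodic_le`, via the tree's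
`curlL1_le_periodic`).  All [folklore]; every input is a tree theorem BY NAME (`hasDerivAt_fineAction_vary`,
`abs_nReTr_le_opNorm`, `curl_mem_skewAdjoint`, `nReTr_eq_zero_of_mem_skewAdjoint`, `curlL1_le_periodic`).

HONEST FRAMING.  Finite-T⁴ bookkeeping (rung (B)+1); elementary; NOTHING about Bałaban's minimisers is asserted; no
conditional of the cell is used or hidden; NOT infinite volume ∕ mass gap ∕ Clay ∕ summit progress; NE3 NOT proved.
ABSOLUTE RULE kept: no printed sentence is a hypothesis (context: [Balaban1985Variational] (26)–(28) p. 282).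
PLACEMENT: `Summits/QuantumFields/BalabanUV/`; imports the accepted `Support.AveragingDeficitDualResidual` only; moves nothing.
-/

set_option autoImplicit false

open scoped BigOperators Matrix Matrix.Norms.L2Operator
open NormedSpace Finset

namespace Summit.QuantumFields.BalabanUV.T4Continuum.NE3EnergySource

open Literature.MathematicalPhysics.QuantumFieldTheory.Balaban1983to89
open B7Prop1Explicit B7Prop2Explicit MatrixLog UnitaryModel MatrixNorms
open T4AveragingDeficitWall hiding Site Plane Plaq Bond
open T4AveragingDeficitWallBoundary (IsPeriodicCfg periodBox)
open AveragingDeficitPeriodicCounting (IsPeriodicDir)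
open AveragingDeficitTransport (curl_mem_skewAdjoint nReTr_eq_zero_of_mem_skewAdjoint)
open AveragingDeficitDualResidual (curlL1_le_periodic)

noncomputable section

variable {d : ℕ} {n : Type*} [Fintype n] [DecidableEq n]

local notation "𝕄" => Matrix n n ℂ
local notation "Site" => B7Prop1Explicit.Site
local notation "Plaq" => T4AveragingDeficitWall.Plaq
local notation "Plane" => T4AveragingDeficitWall.Plane

/-! ## §1 One plaquette: a skew insertion sees only `V(∂p) − 1` -/

/-- For skew-adjoint `C` and any `H` with `‖H − 1‖ ≤ a`: `|Re tr(C·H)| ≤ a·‖C‖` (normalised trace, operator norm) —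
because `Re tr C = 0`, `C·H = C·(H − 1) + C`. [folklore] -/
theorem abs_nReTr_mul_le_of_skew {C H : 𝕄} (hC : C ∈ skewAdjoint 𝕄) {a : ℝ} (hH : ‖H - 1‖ ≤ a) :
    |nReTr (C * H)| ≤ a * ‖C‖ := by
  have hsplit : C * H = C * (H - 1) + C := by rw [mul_sub, mul_one, sub_add_cancel]
  have hadd : nReTr (C * (H - 1) + C) = nReTr (C * (H - 1)) + nReTr C := by
    rw [← nReTrL_apply, ← nReTrL_apply, ← nReTrL_apply, map_add]
  rw [hsplit, hadd, nReTr_eq_zero_of_mem_skewAdjoint hC, add_zero]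
  calc |nReTr (C * (H - 1))| ≤ ‖C * (H - 1)‖ := abs_nReTr_le_opNorm _
    _ ≤ ‖C‖ * ‖H - 1‖ := norm_mul_le _ _
    _ ≤ ‖C‖ * a := mul_le_mul_of_nonneg_left hH (norm_nonneg _)
    _ = a * ‖C‖ := mul_comm _ _

/-! ## §2 A window: the first-variation sum against the plaquette radius -/

/-- **WINDOW FORM**: for `U(N)`-valued `V` whose plaquette variables on the window `W` lie within `a` of `1`, and a
`𝔲(N)` direction `ψ`:  `|Σ_{p∈W} Re tr((d_Vψ)(p)·V(∂p))| ≤ a · Σ_{p∈W} ‖(d_Vψ)(p)‖`. [folklore] -/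
theorem abs_sum_nReTr_curl_fhol_le {V : Site d → Fin d → 𝕄ˣ} (hV : IsUnitaryCfg V) {ψ : Site d → Fin d → 𝕄}
    (hψ : IsSkewDir ψ) (W : Finset (Plaq d)) {a : ℝ}
    (ha : ∀ p ∈ W, ‖((fhol V p : 𝕄ˣ) : 𝕄) - 1‖ ≤ a) :
    |∑ p ∈ W, nReTr (curl V ψ p * ((fhol V p : 𝕄ˣ) : 𝕄))| ≤ a * ∑ p ∈ W, ‖curl V ψ p‖ := by
  rw [Finset.mul_sum]
  refine (Finset.abs_sum_le_sum_abs _ _).trans (Finset.sum_le_sum fun p hp => ?_)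
  exact abs_nReTr_mul_le_of_skew (curl_mem_skewAdjoint hV hψ p) (ha p hp)

/-! ## §3 The first variation of the Wilson action -/

/-- **LEAF L7 AT THE BACKGROUND POINT**: the derivative at `s = 0` of the Wilson action of the window `W` along
`V e^{sψ}` — ANY `D` with `HasDerivAt (s ↦ fineAction (vary V ψ s) W) D 0` (the tree's `hasDerivAt_fineAction_vary`
supplies one; uniqueness of derivatives) — satisfies `|D| ≤ a · Σ_{p∈W} ‖(d_Vψ)(p)‖` when the plaquette variables of `V`
on `W` are within `a` of `1`.  (Printed sup counterpart at the background: B11 (28) «|J| < C₁B₃ε₁(L^jη)⁻³».)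
[folklore] -/
theorem abs_firstVariation_le {V : Site d → Fin d → 𝕄ˣ} (hV : IsUnitaryCfg V) {ψ : Site d → Fin d → 𝕄}
    (hψ : IsSkewDir ψ) (W : Finset (Plaq d)) {a : ℝ}
    (ha : ∀ p ∈ W, ‖((fhol V p : 𝕄ˣ) : 𝕄) - 1‖ ≤ a) {D : ℝ}
    (hD : HasDerivAt (fun s : ℝ => fineAction (vary V ψ s) W) D 0) :
    |D| ≤ a * ∑ p ∈ W, ‖curl V ψ p‖ := by
  have hD' := hasDerivAt_fineAction_vary V ψ W
  rw [hD.unique hD', abs_neg]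
  exact abs_sum_nReTr_curl_fhol_le hV hψ W ha

/-- The plaquette-radius hypothesis from the tree's `SmallField` class: `SmallField V a` bounds EVERY plaquette variable,
in particular those of any window. [folklore] -/
theorem fhol_sub_one_le_of_smallField {V : Site d → Fin d → 𝕄ˣ} {a : ℝ} (hVa : SmallField V a)
    (W : Finset (Plaq d)) : ∀ p ∈ W, ‖((fhol V p : 𝕄ˣ) : 𝕄) - 1‖ ≤ a :=
  fun p _ => hVa p.1 p.2.1.1 p.2.1.2 (ne_of_lt p.2.2)

/-! ## §4 One period of a periodic direction: the dual-`ℓ¹` form -/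

/-- The curl sum over the product window `N ×ˢ univ` is the tree's `curlL1`. [folklore] -/
theorem sum_product_norm_curl (V : Site d → Fin d → 𝕄ˣ) (ψ : Site d → Fin d → 𝕄) (N : Finset (Site d)) :
    ∑ p ∈ N ×ˢ (Finset.univ : Finset (Plane d)), ‖curl V ψ p‖ = curlL1 V ψ N := by
  rw [curlL1, Finset.sum_product]

/-- **LEAF L7, PERIODIC FORM**: over one period `[0,P)^d × planes` of a `P`-periodic `𝔲(N)` direction on a `U(N)`
configuration in the small-field class `SmallField V a`:
`|d/ds|₀ A_{period}(V e^{sψ})| ≤ 2·#planes·a·‖ψ‖_{ℓ¹(period)}` — the first variation is `O(a)` in the dual-`ℓ¹` norm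
(the `σ` of `NE3EnergyPath.pathHessian_lower`'s curvature slot at the background point). [folklore] -/
theorem abs_firstVariation_periodic_le {V : Site d → Fin d → 𝕄ˣ} (hV : IsUnitaryCfg V) {a : ℝ} (ha : 0 ≤ a)
    (hVa : SmallField V a) {ψ : Site d → Fin d → 𝕄} (hψ : IsSkewDir ψ) {P : ℕ} (hP : 1 ≤ P)
    (hψP : IsPeriodicDir ψ (P : ℤ)) {D : ℝ}
    (hD : HasDerivAt (fun s : ℝ => fineAction (vary V ψ s) (periodBox P ×ˢ (Finset.univ : Finset (Plane d)))) D 0) :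
    |D| ≤ 2 * Fintype.card (Plane d) * a * dirL1 ψ (periodBox P) := by
  have h1 := abs_firstVariation_le hV hψ _ (fhol_sub_one_le_of_smallField hVa _) hD
  rw [sum_product_norm_curl] at h1
  have h2 := curlL1_le_periodic hV hP hψP
  calc |D| ≤ a * curlL1 V ψ (periodBox P) := h1
    _ ≤ a * (2 * Fintype.card (Plane d) * dirL1 ψ (periodBox P)) := mul_le_mul_of_nonneg_left h2 ha
    _ = 2 * Fintype.card (Plane d) * a * dirL1 ψ (periodBox P) := by ring

/-! ## §5 Non-vacuity and sharpness remarks -/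

/-- NON-VACUITY ∕ CONSISTENCY WITH FERMAT: at the FLAT configuration (`a = 0`) the bound forces `D = 0` — the flat
configuration is critical along every `𝔲(N)` direction, as row NE3-R2's `fineCritical_flat` says directly. [folklore] -/
theorem firstVariation_flat_eq_zero [Nonempty n] {ψ : Site d → Fin d → 𝕄} (hψ : IsSkewDir ψ) (W : Finset (Plaq d))
    {D : ℝ} (hD : HasDerivAt (fun s : ℝ => fineAction (vary (fun (_ : Site d) (_ : Fin d) => (1 : 𝕄ˣ)) ψ s) W) D 0) :
    D = 0 := by
  have hu : IsUnitaryCfg (fun (_ : Site d) (_ : Fin d) => (1 : 𝕄ˣ)) := fun _ _ => (unitaryUnits 𝕄).one_mem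
  have ha : ∀ p ∈ W, ‖((fhol (fun (_ : Site d) (_ : Fin d) => (1 : 𝕄ˣ)) p : 𝕄ˣ) : 𝕄) - 1‖ ≤ 0 := by
    intro p _
    rw [fhol, hol_flat, Units.val_one, sub_self, norm_zero]
  have h := abs_firstVariation_le hu hψ W ha hD
  rw [zero_mul] at h
  exact abs_eq_zero.mp (le_antisymm h (abs_nonneg D))

end

end Summit.QuantumFields.BalabanUV.T4Continuum.NE3EnergySource
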